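import Literature.Algebra.Homology.ExtDualityLadder
import HarnessLib

/-!
# The duality map `α¹` on a quotient `P/m`: reduction to the pairing `(c, y) ↦ inv ((y ∘ [S]) ∘ c)` on
# `Ext⁰(P, C) × Ext¹(P, P/m)` (Milne ADT I Lemma 1.7 for `M = ℤ/mℤ`, formal part)

Topic `Algebra/Homology`; namespace `Literature.Algebra.Homology.ExtDuality`.  Theorems only, for
Mathlib's `Abelian.Ext` in any abelian category with `HasExt`; no definition, no named fact, no
instance, no `sorry`.  Sequel of `ExtDualityPairing` / `ExtDualityLadder`.

Milne ADT I Lemma 1.7: for `M = ℤ/mℤ`, "`α¹(G, ℤ/mℤ) : (C_G)_m → (G^{ab})_m^*`… is induced by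
`rec_G`", read off `0 → ℤ —m→ ℤ → ℤ/m → 0`: `Ext¹_G(ℤ/m, C) = C^G/m` (as `H¹(G, C) = 0`) and
`H¹(G, ℤ/m) ↪ H²(G, ℤ)[m]` (as `H¹(G, ℤ) = 0`), the pairing becoming `(c, χ) ↦ inv(δχ ∪ c)`.  Here,
for a short exact `S : 0 → X₁ —f→ X₂ —g→ X₃ → 0` (think `X₁ = X₂ = P`, `f = m • 𝟙`, `X₃ = P/m`),
`inv : Ext²(P, C) →+ Q`:

* `exists_extClass_comp_eq` (`δ : Ext⁰(X₁, C) → Ext¹(X₃, C)` is onto when `Ext¹(X₂, C) = 0`),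
  `extClass_comp_eq_zero_iff` (its kernel is `f^* Ext⁰(X₂, C)`);
* `comp_extClass_injective` (`δ' : Ext¹(P, X₃) → Ext²(P, X₁)` is injective when `Ext¹(P, X₂) = 0`),
  `exists_comp_extClass_eq_iff` (its image is the kernel of `f_*`);
* `pairing_extClass_comp_eq` : `⟨δ c, y⟩ = inv ((y ∘ [S]) ∘ c)`;
* **`adjointInjective_X₃_iff`**, **`adjointSurjective_X₃_iff`**: `α(X₃)` in bidegree `(r, s) = (1, 1)`
  is injective, resp. surjective, iff the pairing `(c, y) ↦ inv ((y ∘ [S]) ∘ c)` on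
  `Ext⁰(X₁, C) × Ext¹(P, X₃)` is left-nondegenerate modulo `f^* Ext⁰(X₂, C)`, resp. represents every
  additive functional on `Ext¹(P, X₃)`.

Written for Route A of the Poitou–Tate programme of crux `stmt-BirchSwinnertonDyer-19295` (cell
`bsd-schneider-ideate`, seat door-c4 gen 15): the hypothesis `adjointBijective_one_zmod` of
`DiscreteRepTateDuality.TateDualityHypotheses` (Milne's (b): `α¹(U, ℤ/m)` bijective) in the form the
reciprocity law delivers it (`inv(δχ ∪ c) = χ(rec c)`, `C_F/C_F^m ≅ Γ_F^{ab}/m`).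
HONEST FRAMING: homological algebra only.

## References
* J. S. Milne, *Arithmetic Duality Theorems* (2nd ed. 2006), I §1, Lemma 1.7 and Theorem 1.8 (b). [MilneADT2006]
* D. Harari, *Galois Cohomology and Class Field Theory*, Universitext (2020), §16.3 Lemma 16.19 –
  Theorem 16.21. [Harari2020]
-/

noncomputable section

universe w' w v u

namespace Literature.Algebra.Homology

namespace ExtDuality

open CategoryTheory CategoryTheory.Abelian

variable {𝒞 : Type u} [Category.{v} 𝒞] [Abelian 𝒞] [HasExt.{w} 𝒞]
  {P C : 𝒞} {Q : Type w'} [AddCommGroup Q] (inv : Ext P C 2 →+ Q)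
  {S : ShortComplex 𝒞} (hS : S.ShortExact)

/-! ## §1 `Ext¹(X₃, C)` as a quotient of `Ext⁰(X₁, C)` -/

/-- **`δ : Ext⁰(X₁, C) → Ext¹(X₃, C)` is onto when `Ext¹(X₂, C) = 0`** (Milne: `Ext¹_G(ℤ/m, C) = C^G/m`
because `H¹(G, C) = 0`). [cite: MilneADT2006, I Lemma 1.7] -/
theorem exists_extClass_comp_eq (C : 𝒞) (h1 : ∀ x : Ext S.X₂ C 1, x = 0) (x : Ext S.X₃ C 1) :
    ∃ c : Ext S.X₁ C 0, hS.extClass.comp c (add_zero 1) = x :=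
  Ext.contravariant_sequence_exact₃ (hS := hS) (Y := C) x (h1 _) (add_zero 1)

/-- **Kernel of `δ`**: `[S] ∘ c = 0` iff `c = f^* c₂` for some `c₂ ∈ Ext⁰(X₂, C)`.
[cite: MilneADT2006, I Lemma 1.7] -/
theorem extClass_comp_eq_zero_iff (C : 𝒞) (c : Ext S.X₁ C 0) :
    hS.extClass.comp c (add_zero 1) = 0 ↔
      ∃ c₂ : Ext S.X₂ C 0, (Ext.mk₀ S.f).comp c₂ (zero_add 0) = c := by
  constructor
  · intro hc
    exact Ext.contravariant_sequence_exact₁ (hS := hS) (Y := C) c (add_zero 1) hc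
  · rintro ⟨c₂, rfl⟩
    exact hS.extClass_comp_assoc c₂ (h := add_zero 1)

/-! ## §2 `Ext¹(P, X₃)` inside `Ext²(P, X₁)` -/

omit inv in
/-- **`δ' : Ext¹(P, X₃) → Ext²(P, X₁)`, `y ↦ y ∘ [S]`, is injective when `Ext¹(P, X₂) = 0`** (Milne:
`H¹(G, ℤ/m) ↪ H²(G, ℤ)` because `H¹(G, ℤ) = 0`). [cite: MilneADT2006, I Lemma 1.7] -/
theorem comp_extClass_injective (P : 𝒞) (h1 : ∀ y : Ext P S.X₂ 1, y = 0) :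
    Function.Injective (hS.extClass.postcomp P (rfl : 1 + 1 = 2)) := by
  rw [injective_iff_map_eq_zero]
  intro y hy
  obtain ⟨y₂, hy₂⟩ := Ext.covariant_sequence_exact₃ (hS := hS) (X := P) y rfl hy
  rw [h1 y₂, Ext.zero_comp] at hy₂
  exact hy₂.symm

omit inv in
/-- **Image of `δ'`**: `t ∈ Ext²(P, X₁)` is `y ∘ [S]` iff `f_* t = 0`. [cite: MilneADT2006, I Lemma 1.7] -/
theorem exists_comp_extClass_eq_iff (P : 𝒞) (t : Ext P S.X₁ 2) :
    (∃ y : Ext P S.X₃ 1, y.comp hS.extClass (rfl : 1 + 1 = 2) = t) ↔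
      t.comp (Ext.mk₀ S.f) (add_zero 2) = 0 := by
  constructor
  · rintro ⟨y, rfl⟩
    rw [Ext.comp_assoc_of_third_deg_zero, hS.extClass_comp, Ext.comp_zero]
  · intro ht
    exact Ext.covariant_sequence_exact₁ (hS := hS) (X := P) t ht rfl

/-! ## §3 The pairing on `Ext⁰(X₁, C) × Ext¹(P, X₃)` -/

/-- **`⟨δ c, y⟩ = inv ((y ∘ [S]) ∘ c)`**: the duality pairing on `Ext¹(X₃, C) × Ext¹(P, X₃)` pulled back
along `δ` (Milne: `(c, χ) ↦ inv(δχ ∪ c)`). [cite: MilneADT2006, I Lemma 1.7][cite: Harari2020, §16.3] -/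
theorem pairing_extClass_comp_eq (c : Ext S.X₁ C 0) (y : Ext P S.X₃ 1) :
    pairing inv S.X₃ (show 1 + 1 = 2 from rfl) (hS.extClass.comp c (add_zero 1)) y =
      inv ((y.comp hS.extClass (rfl : 1 + 1 = 2)).comp c (add_zero 2)) := by
  rw [pairing_extClass_comp inv hS (add_zero 1) (rfl : 1 + 1 = 2) (show 1 + 1 = 2 from rfl)
    (show 2 + 0 = 2 from rfl) c y, pairing_apply]

/-! ## §4 `α(X₃)` in bidegree `(1, 1)` through the pairing -/

/-- **`α¹(X₃)` is injective iff the pairing `(c, y) ↦ inv ((y ∘ [S]) ∘ c)` is nondegenerate on the left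
modulo `f^* Ext⁰(X₂, C)`** (when `Ext¹(X₂, C) = 0`).  For `S = (0 → ℤ —m→ ℤ → ℤ/m → 0)`:
`c ∈ C^G` pairs trivially with every `χ` iff `c ∈ m C^G`. [cite: MilneADT2006, I Lemma 1.7, Theorem 1.8 (b)] -/
theorem adjointInjective_X₃_iff (h1 : ∀ x : Ext S.X₂ C 1, x = 0) :
    AdjointInjective inv S.X₃ (show 1 + 1 = 2 from rfl) ↔
      ∀ c : Ext S.X₁ C 0, (∀ y : Ext P S.X₃ 1, inv ((y.comp hS.extClass (rfl : 1 + 1 = 2)).comp c (add_zero 2)) = 0) →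
        ∃ c₂ : Ext S.X₂ C 0, (Ext.mk₀ S.f).comp c₂ (zero_add 0) = c := by
  constructor
  · intro hinj c hc
    rw [← extClass_comp_eq_zero_iff hS C c]
    apply (injective_iff_map_eq_zero _).1 hinj
    ext y
    rw [AddMonoidHom.zero_apply]
    exact (pairing_extClass_comp_eq inv hS c y).trans (hc y)
  · intro h
    rw [AdjointInjective, injective_iff_map_eq_zero]
    intro x hx
    obtain ⟨c, rfl⟩ := exists_extClass_comp_eq hS C h1 x
    rw [extClass_comp_eq_zero_iff hS C c]
    refine h c fun y => ?_
    rw [← pairing_extClass_comp_eq inv hS c y]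
    exact DFunLike.congr_fun hx y

/-- **`α¹(X₃)` is surjective iff every additive functional on `Ext¹(P, X₃)` is
`y ↦ inv ((y ∘ [S]) ∘ c)` for some `c ∈ Ext⁰(X₁, C)`** (when `Ext¹(X₂, C) = 0`).  For
`S = (0 → ℤ —m→ ℤ → ℤ/m → 0)`: every functional on `Hom(G, ℤ/m)` is `χ ↦ inv(δχ ∪ c)`.
[cite: MilneADT2006, I Lemma 1.7, Theorem 1.8 (b)] -/
theorem adjointSurjective_X₃_iff (h1 : ∀ x : Ext S.X₂ C 1, x = 0) :
    AdjointSurjective inv S.X₃ (show 1 + 1 = 2 from rfl) ↔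
      ∀ Φ : Ext P S.X₃ 1 →+ Q, ∃ c : Ext S.X₁ C 0,
        ∀ y : Ext P S.X₃ 1, Φ y = inv ((y.comp hS.extClass (rfl : 1 + 1 = 2)).comp c (add_zero 2)) := by
  constructor
  · intro hsurj Φ
    obtain ⟨x, hx⟩ := hsurj Φ
    obtain ⟨c, rfl⟩ := exists_extClass_comp_eq hS C h1 x
    exact ⟨c, fun y => by rw [← hx, ← pairing_extClass_comp_eq inv hS c y]⟩
  · intro h Φ
    obtain ⟨c, hc⟩ := h Φ
    refine ⟨hS.extClass.comp c (add_zero 1), ?_⟩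
    ext y
    rw [hc y, ← pairing_extClass_comp_eq inv hS c y]

end ExtDuality

end Literature.Algebra.Homology
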